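import Literature.Topology.FourManifolds.SPC4HandlesNormalFormProofs
import Literature.Topology.FourManifolds.HeegaardSplittingMorseProofs
import Literature.Topology.FourManifolds.MorseDiscLemma
import Literature.Topology.FourManifolds.ImmersionOrientation
import HarnessLib

/-!
# A `3`-manifold with boundary `S²` built from `0`- and `1`-handles is a ball

Topic `Literature/Topology/FourManifolds`; a ball criterion assembled from the tree's Morse
theory, for the fact seat of Alexander's theorem
(`provefact-Literature.Topology.FourManifolds.SphereEmbedding.schoenflies_exists_ball`, Schultens
(2014), Thm. 3.2.5).  **Everything in this file is proved; no definitions, no named facts.**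

* `HandlebodyBall.exists_isMorseAdapted_ncard_zero_eq_one` — on a compact connected manifold
  with boundary, an adapted Morse function with no critical points of index `≥ 2` can be replaced
  by one with exactly one critical point of index `0` and none of index `≥ 2` (induction on the
  tree's cancellation step `exists_isMorseAdapted_ncard_criticalSetOfIndex_zero_add_one_eq_holds`,
  Milnor 1965, Thm. 8.1 Index 0).
* `HandlebodyBall.nonempty_diffeomorph_closedBall_of_index_le_one` — **a compact connected
  orientable `3`-manifold with boundary diffeomorphic to `S²` carrying an adapted Morse function
  all of whose critical points have index `≤ 1` is diffeomorphic to `𝔻³`**: after cancellation it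
  is a genus-`g` handlebody (`IsHandlebody`, `LickorishWallace.lean`) with the boundary of the
  genus-`0` handlebody `𝔻³` (`isHandlebody_zero_closedBall`), so `g = 0`
  (`IsHandlebody.genus_eq_of_diffeomorph_boundary_holds`: `χ(∂H) = 2 - 2g`), and a Morse
  function with a single critical point, of index `0`, gives the ball
  (`IsMorseAdapted.nonempty_diffeomorph_closedBall`, `MorseDiscLemma.lean`).

In the exp-height line this replaces the boundary-connected-sum lemma of the printed proof
("attaching the remaining portions of `B`, which are `3`-balls, along discs", Schultens (2014),
PDF p. 44): the region bounded by the sphere is certified a ball as soon as the exp-height Morse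
function `e^{t⟨v,·⟩} F` (`ExpHeightCritical.lean`) has no critical point of index `2`, i.e. as
soon as no boundary point with outward normal `+v` is a local minimum of the height.

## References

* J. Schultens, *Introduction to 3-Manifolds*, GSM 151 (2014), Def. 6.1.5, Ex. 6.1.8,
  Thm. 3.2.5. [Schultens2014]
* J. Milnor, *Lectures on the h-cobordism theorem*, Princeton (1965), Thm. 8.1 (Index 0).
  [MilnorHCobordism1965]
* A. Juhász, *Differential and Low-Dimensional Topology*, LMS Student Texts 104 (2023), §3.5 and
  proof of Prop. 3.28. [Juhasz2023]
-/

open scoped Manifold ContDiff Topology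
open Set Function Metric

noncomputable section

namespace Literature.Topology.FourManifolds

namespace HandlebodyBall

/-- **Cancelling surplus `0`-handles** (Milnor 1965, Thm. 8.1 Index 0; Matsumoto 2002,
Thm. 3.35): on a compact connected manifold with boundary, an adapted Morse function without
critical points of index `≥ 2` can be replaced by one with a single critical point of index `0`
and still none of index `≥ 2` — by the tree's cancellation step
`exists_isMorseAdapted_ncard_criticalSetOfIndex_zero_add_one_eq_holds`, inductively.
[cite: MilnorHCobordism1965, Thm. 8.1 Index 0] -/
theorem exists_isMorseAdapted_ncard_zero_eq_one {n : ℕ} {W : Type}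
    [TopologicalSpace W] [T2Space W] [SecondCountableTopology W] [CompactSpace W]
    [ConnectedSpace W] [Nonempty W] [ChartedSpace (EuclideanHalfSpace (n + 1)) W]
    [IsManifold (𝓡∂ (n + 1)) ∞ W] :
    ∀ (m : ℕ) (f : W → ℝ), IsMorseAdapted (𝓡∂ (n + 1)) f →
      (criticalSetOfIndex (𝓡∂ (n + 1)) f 0).ncard = m + 1 →
      (∀ k, 2 ≤ k → (criticalSetOfIndex (𝓡∂ (n + 1)) f k).ncard = 0) →
      ∃ g : W → ℝ, IsMorseAdapted (𝓡∂ (n + 1)) g ∧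
        (criticalSetOfIndex (𝓡∂ (n + 1)) g 0).ncard = 1 ∧
        ∀ k, 2 ≤ k → (criticalSetOfIndex (𝓡∂ (n + 1)) g k).ncard = 0 := by
  intro m
  induction m with
  | zero => exact fun f hf h0 h2 => ⟨f, hf, h0, h2⟩
  | succ m ih =>
    intro f hf h0 h2
    obtain ⟨g, hg, hg0, -, hgk⟩ :=
      exists_isMorseAdapted_ncard_criticalSetOfIndex_zero_add_one_eq_holds n W f hf (by omega)
    refine ih g hg (by omega) fun k hk => ?_
    rw [hgk k hk, h2 k hk]

/-- **A compact connected orientable `3`-manifold with boundary diffeomorphic to `S²` which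
carries an adapted Morse function all of whose critical points have index `≤ 1` is
diffeomorphic to the closed `3`-ball.**  Cancel the surplus `0`-handles
(`exists_isMorseAdapted_ncard_zero_eq_one`); the result is a genus-`g` handlebody
(`IsHandlebody`, `LickorishWallace.lean`) whose boundary is diffeomorphic to that of the genus-`0`
handlebody `𝔻³` (`isHandlebody_zero_closedBall`), so `g = 0` by
`IsHandlebody.genus_eq_of_diffeomorph_boundary_holds` (`χ(∂H) = 2 - 2g`); a Morse function
with a single critical point, of index `0`, then gives the ball
(`IsMorseAdapted.nonempty_diffeomorph_closedBall`, `MorseDiscLemma.lean`).  This is the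
criterion by which the exp-height line of the fact seat of Alexander's theorem
(`provefact-Literature.Topology.FourManifolds.SphereEmbedding.schoenflies_exists_ball`) certifies
balls without the boundary-connected-sum lemma. [cite: Schultens2014, Def. 6.1.5, Ex. 6.1.8 and Thm. 3.2.5]
[cite: MilnorHCobordism1965, Thm. 8.1 Index 0] -/
theorem nonempty_diffeomorph_closedBall_of_index_le_one {W : Type}
    [TopologicalSpace W] [T2Space W] [SecondCountableTopology W] [CompactSpace W]
    [ConnectedSpace W] [Nonempty W] [ChartedSpace (EuclideanHalfSpace 3) W]
    [IsManifold (𝓡∂ 3) ∞ W] (hor : IsOrientable (𝓡∂ 3) W) (h : IsHandlebodyOfIndexLE 2 1 W)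
    (b : BoundaryData (𝓡∂ 3) W (𝓡 2))
    (φ : b.carrier ≃ₘ⟮𝓡 2, 𝓡 2⟯ (sphere (0 : EuclideanSpace ℝ (Fin 3)) 1)) :
    Nonempty (W ≃ₘ⟮𝓡∂ 3, 𝓡∂ 3⟯ (closedBall (0 : EuclideanSpace ℝ (Fin 3)) 1)) := by
  obtain ⟨f, hf, hidx⟩ := h
  have hfin : ∀ (g : W → ℝ), IsMorseAdapted (𝓡∂ 3) g → ∀ k,
      (criticalSetOfIndex (𝓡∂ 3) g k).Finite := fun g hg k =>
    (IsMorse.finite_criticalSet_holds hg.isMorse).subset (criticalSetOfIndex_subset _ g k)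
  -- no critical points of index `≥ 2`
  have h2 : ∀ k, 2 ≤ k → (criticalSetOfIndex (𝓡∂ 3) f k).ncard = 0 := by
    intro k hk
    rw [Set.ncard_eq_zero (hfin f hf k)]
    ext z
    simp only [mem_criticalSetOfIndex, mem_empty_iff_false, iff_false, not_and]
    intro hz hzk
    have := hidx z hz
    change morseIndex (𝓡∂ 3) f z ≤ 1 at this
    omega
  -- at least one critical point of index `0`
  obtain ⟨p₀, hp₀⟩ := hf.exists_mem_criticalSetOfIndex_zero
  have hpos : 0 < (criticalSetOfIndex (𝓡∂ 3) f 0).ncard :=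
    (Set.ncard_pos (hfin f hf 0)).2 ⟨p₀, hp₀⟩
  obtain ⟨m, hm⟩ : ∃ m, (criticalSetOfIndex (𝓡∂ 3) f 0).ncard = m + 1 :=
    ⟨(criticalSetOfIndex (𝓡∂ 3) f 0).ncard - 1, by omega⟩
  -- cancel down to one `0`-handle
  obtain ⟨g, hg, hg0, hg2⟩ := exists_isMorseAdapted_ncard_zero_eq_one m f hf hm h2
  -- `W` is a handlebody of genus `c₁(g)`
  set c₁ : ℕ := (criticalSetOfIndex (𝓡∂ 3) g 1).ncard with hc₁
  have hHD : HasHandleDecomposition 2 W (handleCount 1 c₁) := by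
    refine ⟨g, hg, fun k => ?_⟩
    rcases Nat.lt_or_ge k 2 with hk | hk
    · interval_cases k
      · simpa using hg0
      · simp [handleCount, hc₁]
    · rw [hg2 k hk]
      simp [handleCount, show k ≠ 0 by omega, show k ≠ 1 by omega]
  have hH : IsHandlebody c₁ W := ⟨inferInstance, inferInstance, hor, hHD⟩
  -- genus zero: the boundary is that of `𝔻³`
  have hgenus : c₁ = 0 :=
    IsHandlebody.genus_eq_of_diffeomorph_boundary_holds c₁ 0 W
      (closedBall (0 : EuclideanSpace ℝ (Fin 3)) 1) hH isHandlebody_zero_closedBall b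
      (closedBallBoundaryData 2) φ
  -- hence `g` has a single critical point, of index `0`
  obtain ⟨p, hp⟩ := hg.exists_mem_criticalSetOfIndex_zero
  have huniq : ∀ q, IsMCriticalPt (𝓡∂ 3) g q → q = p := by
    intro q hq
    set k := morseIndex (𝓡∂ 3) g q with hk
    have hqk : q ∈ criticalSetOfIndex (𝓡∂ 3) g k := ⟨hq, rfl⟩
    rcases Nat.lt_or_ge k 2 with hk2 | hk2
    · interval_cases k
      · -- index 0: the singleton
        obtain ⟨a, ha⟩ := Set.ncard_eq_one.1 hg0
        have hq' : q = a := by simpa [ha] using hqk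
        have hp' : p = a := by simpa [ha] using hp
        rw [hq', hp']
      · -- index 1: none
        have h10 : (criticalSetOfIndex (𝓡∂ 3) g 1).ncard = 0 := by rw [← hc₁, hgenus]
        rw [Set.ncard_eq_zero (hfin g hg 1)] at h10
        rw [h10] at hqk
        exact hqk.elim
    · have := hg2 k hk2
      rw [Set.ncard_eq_zero (hfin g hg k)] at this
      rw [this] at hqk
      exact hqk.elim
  exact IsMorseAdapted.nonempty_diffeomorph_closedBall (k := 2) (by norm_num) hg hp.1 huniq hp.2

end HandlebodyBall

end Literature.Topology.FourManifolds

end
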